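import Mathlib
import Literature.NumberTheory.ModularForms.LevelThreeIdentities
import Literature.NumberTheory.ModularForms.EisensteinE4Hypergeometric
import Literature.NumberTheory.Automorphic.ZhouLegendreGreenValues
import HarnessLib

/-!
# `𝓟(iu) = P_{−1/3}(ξ)²` and `∫_{u>1/√3} f₃(iu) du = (108π)⁻¹ ∫₀¹ P_{−1/3}(ξ)² dξ` (level `3`)

[topic NumberTheory/ModularForms]

The two real-axis inputs of `GreenLevelThreeEichlerIntegral.higherGreen_cmLevelThree_of_axis`
(Zhou 2015, Remark 9, level `3`):

* the level-3 forms on the imaginary axis are real (`eisThree_axisPt`, `deltaThree_axisPt`,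
  `tThree_axisPt_eq`, `fThree_axisPt_real`);
* **Ramanujan's cubic signature identity** `𝓟(iu) = ₂F₁(⅓,⅔;1;x₃)² = P_{−1/3}(ξ)²`,
  `x₃ = 27/(t+27)`, `ξ = 1 − 2x₃`, `t = (η(iu)/η(3iu))¹²`, for `u > √3/6` (`pR_eq_hypergeometric_sq`),
  proved WITHOUT theta functions by the Wronskian method of `EisensteinE4Hypergeometric.lean`: along the
  axis `d/du = −2πD`, and by Ramanujan's `DE₂ = (E₂² − E₄)/12`, `Dt = −𝓟t` and the identities
  `10𝓟² = E₄ + 9E₄(3τ)`, `E₄(t+27) = 𝓟²(t+243)` of `LevelThreeIdentities.lean` the triple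
  `(𝓟, 𝓠 = 3E₂(3·)+E₂, x₃)` satisfies the closed real system `𝓟' = −(π/6)𝓟(𝓠 + 𝓟(8x−4))`,
  `𝓠' = −(π/12)(𝓠² − 16𝓟²)`, `x' = −2π𝓟x(1−x)`; with `y = 𝓟^{1/2}`, `L = y'/y` and
  `Φ = ₂F₁(⅓,⅔;1;x)` the normalised Wronskian `V = (Φ' − LΦ)/y` has `V' = 0`, so `Φ/y` is affine in
  `u` and the limits at `∞` force `Φ = y`;
* the substitution `ξ = (t−27)/(t+27)`: `ξ' = 4π𝓟x(1−x) = 108πΔ₃/𝓟²` (by `𝓟³t = Δ₃(t+27)²`),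
  `ξ(1/√3) = 0`, `ξ → 1`, hence **`∫_{u>1/√3} Δ₃/𝓟 (iu) du = (108π)⁻¹∫₀¹ P_{−1/3}(ξ)² dξ`**
  (`integral_fThree_axis`).

## References
* Y. Zhou, Ramanujan J. 38 (2015), Remark 9 and eq. (P_nu_sqr_E2_diff). [cite: Zhou2015, Remark 9]
* B. C. Berndt, S. Bhargava, F. G. Garvan, Trans. AMS 347 (1995) (cubic signature). [folklore]
-/

noncomputable section

open Complex hiding I
open UpperHalfPlane hiding I
open Filter Topology ModularForm EisensteinSeries Real MeasureTheory Set
open scoped MatrixGroups ModularForm Manifold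

namespace Literature.NumberTheory.ModularForms

open Derivative
open Literature.NumberTheory.EllipticCurves.ModularForms (mulThree coe_mulThree axisPt coe_axisPt im_axisPt
  tendsto_E2_atImInfty)
open Literature.NumberTheory.Automorphic (legendreP)
open Literature.NumberTheory.Automorphic.LegendreP (hasDerivAt_ordinaryHypergeometric continuousOn_ordinaryHypergeometric
  hasSum_ordinaryHypergeometric)

/-! ## 1. The level-3 forms on the imaginary axis -/

/-- `𝓟(iu) = (3e₂(3u) − e₂(u))/2` (real). [folklore] -/
def pR (u : ℝ) : ℝ := (3 * e₂ (3 * u) - e₂ u) / 2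

/-- `𝓠(iu) = 3e₂(3u) + e₂(u)` (real). [folklore] -/
def qR (u : ℝ) : ℝ := 3 * e₂ (3 * u) + e₂ u

/-- `t(iu)` (real part; `t(iu)` is real and positive). [folklore] -/
def tR (u : ℝ) : ℝ := (tThree (axisPt u)).re

/-- `x₃(u) = 27/(t(iu) + 27)`. [folklore] -/
def xR (u : ℝ) : ℝ := 27 / (tR u + 27)

/-- `Δ₃(iu)` (real part; it is real and positive). [folklore] -/
def dR (u : ℝ) : ℝ := (deltaThree (axisPt u)).re

/-- `3·(iu) = i(3u)`. [folklore] -/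
theorem mulThree_axisPt {u : ℝ} (hu : 0 < u) : mulThree (axisPt u) = axisPt (3 * u) := by
  apply UpperHalfPlane.ext
  rw [coe_mulThree, coe_axisPt hu, coe_axisPt (by positivity)]; push_cast; ring

/-- **`𝓟(iu) = pR(u)`.** [folklore] -/
theorem eisThree_axisPt {u : ℝ} (hu : 0 < u) : eisThree (axisPt u) = (pR u : ℂ) := by
  rw [eisThree, mulThree_axisPt hu, E2_axisPt hu, E2_axisPt (by positivity), pR]; push_cast; ring

/-- **`t(iu) = tR(u) > 0`.** [folklore] -/
theorem tThree_axisPt_eq {u : ℝ} (hu : 0 < u) : tThree (axisPt u) = (tR u : ℂ) ∧ 0 < tR u := by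
  obtain ⟨r, hr, hreq⟩ := tThree_axisPt hu
  have : tR u = r := by rw [tR, hreq, Complex.ofReal_re]
  rw [this]; exact ⟨hreq, hr⟩

/-- `x₃(u) ∈ (0, 1)`. [folklore] -/
theorem xR_mem_Ioo {u : ℝ} (hu : 0 < u) : xR u ∈ Set.Ioo (0 : ℝ) 1 := by
  have ht := (tThree_axisPt_eq hu).2
  refine ⟨by rw [xR]; positivity, ?_⟩
  rw [xR, div_lt_one (by linarith)]; linarith

/-- `x₃(1 − x₃) = 27t/(t+27)²`. [folklore] -/
theorem xR_mul_one_sub {u : ℝ} (hu : 0 < u) : xR u * (1 - xR u) = 27 * tR u / (tR u + 27) ^ 2 := by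
  have ht := (tThree_axisPt_eq hu).2
  rw [xR]; field_simp; ring

/-- **`Δ₃(iu) = dR(u) > 0`** (`η(iy) > 0`). [folklore] -/
theorem deltaThree_axisPt {u : ℝ} (hu : 0 < u) : deltaThree (axisPt u) = (dR u : ℂ) ∧ 0 < dR u := by
  have h3u : 0 < 3 * u := by positivity
  have hc1 : ((axisPt u : ℍ) : ℂ) = Complex.I * u := by rw [coe_axisPt hu, mul_comm]
  have hc3 : ((mulThree (axisPt u) : ℍ) : ℂ) = Complex.I * ((3 * u : ℝ) : ℂ) := by rw [coe_mulThree, coe_axisPt hu]; push_cast; ring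
  have hη1 := Literature.Analysis.SpecialFunctions.eta_I_mul_eq_norm hu
  have hη3 := Literature.Analysis.SpecialFunctions.eta_I_mul_eq_norm h3u
  set r1 := ‖η (Complex.I * u)‖ with hr1
  set r3 := ‖η (Complex.I * ((3 * u : ℝ) : ℂ))‖ with hr3
  have h1 : 0 < r1 := norm_pos_iff.mpr (ModularForm.eta_ne_zero (by simp [hu]))
  have h3 : 0 < r3 := norm_pos_iff.mpr (ModularForm.eta_ne_zero (by simp [h3u]))
  have hval : deltaThree (axisPt u) = (((r1 * r3) ^ 6 : ℝ) : ℂ) := by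
    rw [deltaThree, hc1, hc3, hη1, hη3]
    push_cast; ring
  have : dR u = (r1 * r3) ^ 6 := by
    rw [dR, hval, Complex.ofReal_re]
  rw [this]; exact ⟨hval, by positivity⟩

/-- **`f₃(iu) = dR/pR` is real** (the hypothesis `hr` of `higherGreen_cmLevelThree_of_axis`). [folklore] -/
theorem fThree_axisPt_real : ∀ t : ℝ, 0 < t → fThree (axisPt t) = (((dR t / pR t : ℝ)) : ℂ) := fun t ht => by
  rw [fThree, (deltaThree_axisPt ht).1, eisThree_axisPt ht]; push_cast; rfl

/-! ## 2. The identities on the axis -/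

/-- `10𝓟² = e₄ + 9e₄(3u)`. [folklore] -/
theorem ten_pR_sq {u : ℝ} (hu : 0 < u) : 10 * pR u ^ 2 = e₄ u + 9 * e₄ (3 * u) := by
  have h := ten_eisThree_sq (axisPt u)
  rw [eisThree_axisPt hu, mulThree_axisPt hu, E₄_axisPt hu, E₄_axisPt (by positivity)] at h
  exact_mod_cast h

/-- `e₄(t + 27) = 𝓟²(t + 243)` and `e₄(3u)(t + 27) = 𝓟²(t + 3)`. [folklore] -/
theorem e₄_mul_tR {u : ℝ} (hu : 0 < u) :
    e₄ u * (tR u + 27) = pR u ^ 2 * (tR u + 243) ∧ e₄ (3 * u) * (tR u + 27) = pR u ^ 2 * (tR u + 3) := by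
  have h := E₄_mul_tThree_add (axisPt u)
  have h3 := E₄_mulThree_mul_tThree_add (axisPt u)
  rw [eisThree_axisPt hu, (tThree_axisPt_eq hu).1, E₄_axisPt hu] at h
  rw [eisThree_axisPt hu, (tThree_axisPt_eq hu).1, mulThree_axisPt hu, E₄_axisPt (by positivity)] at h3
  exact ⟨by exact_mod_cast h, by exact_mod_cast h3⟩

/-- **`e₄ = 𝓟²(1 + 8x)`** and **`e₄(3u) = 𝓟²(1 − 8x/9)`.** [folklore] -/
theorem e₄_eq {u : ℝ} (hu : 0 < u) : e₄ u = pR u ^ 2 * (1 + 8 * xR u) ∧ e₄ (3 * u) = pR u ^ 2 * (1 - 8 * xR u / 9) := by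
  obtain ⟨h1, h3⟩ := e₄_mul_tR hu
  have ht := (tThree_axisPt_eq hu).2
  have hne : tR u + 27 ≠ 0 := by linarith
  constructor
  · rw [xR]; field_simp; linear_combination h1
  · rw [xR]; field_simp; linear_combination 9 * h3

/-- **`𝓟³·t = Δ₃·(t + 27)²`** on the axis. [folklore] -/
theorem pR_cube_mul_tR {u : ℝ} (hu : 0 < u) : pR u ^ 3 * tR u = dR u * (tR u + 27) ^ 2 := by
  have h := eisThree_cube_mul_tThree (axisPt u)
  rw [eisThree_axisPt hu, (tThree_axisPt_eq hu).1, (deltaThree_axisPt hu).1] at h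
  exact_mod_cast h

/-! ## 3. Derivatives along the axis: the closed system for `(𝓟, 𝓠, x)` -/

/-- `d/du e₂(3u)`. [folklore] -/
theorem hasDerivAt_e₂_three {u : ℝ} (hu : 0 < u) :
    HasDerivAt (fun s => e₂ (3 * s)) (-(2 * π) * ((e₂ (3 * u) * e₂ (3 * u) - e₄ (3 * u)) / 12) * 3) u := by
  have h := (hasDerivAt_e₂ (t := 3 * u) (by positivity)).comp u
    (((hasDerivAt_id' u).const_mul (3 : ℝ)).congr_deriv (mul_one _))
  exact h.congr_of_eventuallyEq (Eventually.of_forall fun s => rfl)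

/-- **`𝓟' = −(π/6)𝓟(𝓠 + 𝓟(8x − 4))`.** [folklore] -/
theorem hasDerivAt_pR {u : ℝ} (hu : 0 < u) : HasDerivAt pR (-(π / 6) * pR u * (qR u + pR u * (8 * xR u - 4))) u := by
  have h := ((hasDerivAt_e₂_three hu).const_mul 3 |>.sub (hasDerivAt_e₂ hu)).div_const 2
  obtain ⟨h4, h43⟩ := e₄_eq hu
  refine (h.congr_of_eventuallyEq (Eventually.of_forall fun s => rfl)).congr_deriv ?_
  rw [h4, h43, qR, pR]
  ring

/-- **`𝓠' = −(π/12)(𝓠² − 16𝓟²)`.** [folklore] -/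
theorem hasDerivAt_qR {u : ℝ} (hu : 0 < u) : HasDerivAt qR (-(π / 12) * (qR u ^ 2 - 16 * pR u ^ 2)) u := by
  have h := (hasDerivAt_e₂_three hu).const_mul 3 |>.add (hasDerivAt_e₂ hu)
  obtain ⟨h4, h43⟩ := e₄_eq hu
  refine (h.congr_of_eventuallyEq (Eventually.of_forall fun s => rfl)).congr_deriv ?_
  rw [h4, h43, qR, pR]
  ring

/-- **`t' = 2π𝓟t`** on the axis (`Dt = −𝓟t`). [folklore] -/
theorem hasDerivAt_tR {u : ℝ} (hu : 0 < u) : HasDerivAt tR (2 * π * pR u * tR u) u := by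
  have h := hasDerivAt_axis mdifferentiable_tThree hu
  have hI : 0 < ((u : ℂ) * Complex.I).im := by simpa using hu
  have hD : normalizedDerivOfComplex tThree (axisPt u) = -(eisThree (axisPt u) * tThree (axisPt u)) := by
    rw [normalizedDerivOfComplex, coe_axisPt hu, (hasDerivAt_tThree_ofComplex hI).deriv]
    simp only [Function.comp_apply]
    have : ofComplex ((u : ℂ) * Complex.I) = axisPt u := rfl
    rw [this]
    have hπ : (2 * π * Complex.I : ℂ) ≠ 0 := by simp [Real.pi_ne_zero]
    field_simp
  rw [hD, eisThree_axisPt hu, (tThree_axisPt_eq hu).1] at h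
  have h2 := hasDerivAt_re_of_hasDerivAt h
  refine (h2.congr_of_eventuallyEq (Eventually.of_forall fun s => rfl)).congr_deriv ?_
  have : (-(2 * (π : ℂ)) * -((pR u : ℂ) * (tR u : ℂ))) = ((2 * π * pR u * tR u : ℝ) : ℂ) := by push_cast; ring
  rw [this, Complex.ofReal_re]

/-- **`x' = −2π𝓟x(1−x)`.** [folklore] -/
theorem hasDerivAt_xR {u : ℝ} (hu : 0 < u) : HasDerivAt xR (-(2 * π) * pR u * xR u * (1 - xR u)) u := by
  have ht := (tThree_axisPt_eq hu).2
  have hne : tR u + 27 ≠ 0 := by linarith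
  have h := ((hasDerivAt_tR hu).add_const 27).inv (by exact hne) |>.const_mul 27
  have hev : xR = fun s => 27 * (tR s + 27)⁻¹ := by funext s; rw [xR, div_eq_mul_inv]
  rw [hev]
  refine h.congr_deriv ?_
  field_simp
  ring

/-! ## 4. `y = 𝓟^{1/2}`, `L = y'/y`, `Φ = ₂F₁(⅓,⅔;1;x)` and the Wronskian -/

/-- `𝓟(iu) > 0` for `u > √3/6` (non-vanishing there, `→ 1`, connectedness). [folklore] -/
theorem pR_pos {u : ℝ} (hu : Real.sqrt 3 / 6 < u) : 0 < pR u := by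
  have hs : 0 < Real.sqrt 3 / 6 := by positivity
  have hne : ∀ s : ℝ, Real.sqrt 3 / 6 < s → pR s ≠ 0 := by
    intro s hs' h0
    have hs0 : 0 < s := hs.trans hs'
    have := eisThree_ne_zero_of_im_gt (τ := axisPt s) (by rw [im_axisPt hs0]; exact hs')
    rw [eisThree_axisPt hs0, h0] at this
    exact this (by simp)
  have hcont : ContinuousOn pR (Set.Ioi (Real.sqrt 3 / 6)) := fun s hs' =>
    (hasDerivAt_pR (hs.trans hs')).continuousAt.continuousWithinAt
  have hlim : Tendsto pR atTop (𝓝 1) := by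
    have h3 : Tendsto (fun s : ℝ => e₂ (3 * s)) atTop (𝓝 1) :=
      tendsto_e₂_atTop.comp (tendsto_id.const_mul_atTop (by norm_num : (0:ℝ) < 3))
    have h := ((h3.const_mul 3).sub tendsto_e₂_atTop).div_const 2
    rw [show ((3 : ℝ) * 1 - 1) / 2 = 1 by norm_num] at h
    exact h.congr fun s => rfl
  have hev := hlim.eventually (Ioi_mem_nhds (by norm_num : (0 : ℝ) < 1))
  rw [Filter.eventually_atTop] at hev
  obtain ⟨t₀, ht₀⟩ := hev
  by_contra hneg
  push Not at hneg
  have hlt : pR u < 0 := lt_of_le_of_ne hneg (hne u hu)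
  set t₁ := max u t₀ with ht₁
  have hgt : 0 < pR t₁ := ht₀ t₁ (le_max_right _ _)
  have hsub : Set.Icc u t₁ ⊆ Set.Ioi (Real.sqrt 3 / 6) := fun s hs' => lt_of_lt_of_le hu hs'.1
  obtain ⟨c, hc, hc0⟩ := intermediate_value_Icc (le_max_left u t₀) (hcont.mono hsub) ⟨hlt.le, hgt.le⟩
  exact hne c (lt_of_lt_of_le hu hc.1) hc0

/-- `y := 𝓟^{1/2}`. [folklore] -/
def yR (u : ℝ) : ℝ := Real.sqrt (pR u)

/-- `L := y'/y = −(π/12)(𝓠 + 𝓟(8x − 4))`. [folklore] -/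
def LR (u : ℝ) : ℝ := -(π / 12) * (qR u + pR u * (8 * xR u - 4))

/-- `y' = L y`. [folklore] -/
theorem hasDerivAt_yR {u : ℝ} (hu : Real.sqrt 3 / 6 < u) : HasDerivAt yR (LR u * yR u) u := by
  have hu0 : 0 < u := lt_trans (by positivity) hu
  have hp := pR_pos hu
  have h := (hasDerivAt_pR hu0).sqrt hp.ne'
  refine h.congr_deriv ?_
  rw [yR, LR]
  have hs : Real.sqrt (pR u) ≠ 0 := (Real.sqrt_pos.mpr hp).ne'
  have hss : Real.sqrt (pR u) ^ 2 = pR u := Real.sq_sqrt hp.le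
  rw [div_eq_iff (mul_ne_zero two_ne_zero hs)]
  linear_combination ((π / 6) * (qR u + pR u * (8 * xR u - 4))) * hss

/-- `L'`. [folklore] -/
theorem hasDerivAt_LR {u : ℝ} (hu : 0 < u) :
    HasDerivAt LR (-(π / 12) * (-(π / 12) * (qR u ^ 2 - 16 * pR u ^ 2) +
      (-(π / 6) * pR u * (qR u + pR u * (8 * xR u - 4)) * (8 * xR u - 4) +
        pR u * (8 * (-(2 * π) * pR u * xR u * (1 - xR u)))))) u := by
  have h := ((hasDerivAt_qR hu).add ((hasDerivAt_pR hu).mul (((hasDerivAt_xR hu).const_mul 8).sub_const 4))).const_mul (-(π / 12))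
  refine (h.congr_of_eventuallyEq (Eventually.of_forall fun s => ?_)).congr_deriv ?_
  · simp only [LR, Pi.add_apply, Pi.mul_apply]
  · ring

/-- `Φ(u) := ₂F₁(⅓, ⅔; 1; x(u))`. [folklore] -/
def PhiR (u : ℝ) : ℝ := ordinaryHypergeometric (1 / 3 : ℝ) (2 / 3) 1 (xR u)

/-- `Φ₁ := Φ' = (2/9)₂F₁(4/3,5/3;2;x)·x'`. [folklore] -/
def PhiR₁ (u : ℝ) : ℝ :=
  (1 / 3 : ℝ) * (2 / 3) / 1 * ordinaryHypergeometric (1 / 3 + 1 : ℝ) (2 / 3 + 1) (1 + 1) (xR u) *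
    (-(2 * π) * pR u * xR u * (1 - xR u))

/-- `|x| < 1` on the axis. [folklore] -/
theorem abs_xR_lt_one {u : ℝ} (hu : 0 < u) : |xR u| < 1 := by
  obtain ⟨h0, h1⟩ := xR_mem_Ioo hu
  rw [abs_of_pos h0]; exact h1

/-- `Φ' = Φ₁`. [folklore] -/
theorem hasDerivAt_PhiR {u : ℝ} (hu : 0 < u) : HasDerivAt PhiR (PhiR₁ u) u := by
  have h := (hasDerivAt_ordinaryHypergeometric (a := (1 / 3 : ℝ)) (b := 2 / 3) (c := 1) (abs_xR_lt_one hu)).comp u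
    (hasDerivAt_xR hu)
  refine (h.congr_of_eventuallyEq (Eventually.of_forall fun s => rfl)).congr_deriv ?_
  rw [PhiR₁]

/-- `Φ₁'`. [folklore] -/
theorem hasDerivAt_PhiR₁ {u : ℝ} (hu : 0 < u) :
    HasDerivAt PhiR₁
      ((1 / 3 : ℝ) * (2 / 3) / 1 * ((1 / 3 + 1) * (2 / 3 + 1) / (1 + 1) *
          ordinaryHypergeometric (1 / 3 + 1 + 1 : ℝ) (2 / 3 + 1 + 1) (1 + 1 + 1) (xR u)) *
          (-(2 * π) * pR u * xR u * (1 - xR u)) ^ 2 +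
        (1 / 3 : ℝ) * (2 / 3) / 1 * ordinaryHypergeometric (1 / 3 + 1 : ℝ) (2 / 3 + 1) (1 + 1) (xR u) *
          (-(2 * π) * ((-(π / 6) * pR u * (qR u + pR u * (8 * xR u - 4))) * xR u * (1 - xR u) +
            pR u * ((-(2 * π) * pR u * xR u * (1 - xR u)) * (1 - xR u) +
              xR u * (-(-(2 * π) * pR u * xR u * (1 - xR u))))))) u := by
  have hx := hasDerivAt_xR hu
  have hp := hasDerivAt_pR hu
  have hg₁ := (hasDerivAt_ordinaryHypergeometric (a := (1 / 3 + 1 : ℝ)) (b := 2 / 3 + 1) (c := 1 + 1)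
    (abs_xR_lt_one hu)).comp u hx
  -- `x'` as a function
  have hx' : HasDerivAt (fun s => -(2 * π) * pR s * xR s * (1 - xR s))
      (-(2 * π) * ((-(π / 6) * pR u * (qR u + pR u * (8 * xR u - 4))) * xR u * (1 - xR u) +
        pR u * ((-(2 * π) * pR u * xR u * (1 - xR u)) * (1 - xR u) + xR u * (-(-(2 * π) * pR u * xR u * (1 - xR u)))))) u := by
    have h0 := ((hp.mul (hx.mul (hx.const_sub 1))).const_mul (-(2 * π)))
    refine (h0.congr_of_eventuallyEq (Eventually.of_forall fun s => ?_)).congr_deriv ?_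
    · simp only [Pi.mul_apply]; ring
    · simp only [Pi.mul_apply]; ring
  have h := (hg₁.const_mul ((1 / 3 : ℝ) * (2 / 3) / 1)).mul hx'
  refine (h.congr_of_eventuallyEq (Eventually.of_forall fun s => ?_)).congr_deriv ?_
  · simp only [PhiR₁, Function.comp_apply, Pi.mul_apply]
  · simp only [Function.comp_apply]; ring

/-- **The polynomial identity behind `((Φ/y)')' = 0`** for the level-3 system:
`x(1−x)·[Φ₁' − 2LΦ₁ + (L² − L')Φ] − x'²·[hypergeometric operator applied to Φ] ≡ 0`
in the free variables `P, Q, x, p (= π), F₀, G₁, G₂`. [folklore] -/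
theorem cubic_key_identity (P Q x p F₀ G₁ G₂ : ℝ) :
    let F₁ := (1 / 3 : ℝ) * (2 / 3) / 1 * G₁
    let F₂ := (1 / 3 : ℝ) * (2 / 3) / 1 * ((1 / 3 + 1) * (2 / 3 + 1) / (1 + 1) * G₂)
    let dP := -(p / 6) * P * (Q + P * (8 * x - 4))
    let dQ := -(p / 12) * (Q ^ 2 - 16 * P ^ 2)
    let dx := -(2 * p) * P * x * (1 - x)
    let L := -(p / 12) * (Q + P * (8 * x - 4))
    let dL := -(p / 12) * (dQ + (dP * (8 * x - 4) + P * (8 * dx)))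
    let ddx := -(2 * p) * (dP * x * (1 - x) + P * (dx * (1 - x) + x * (-dx)))
    let Φ₁ := F₁ * dx
    let dΦ₁ := F₂ * dx ^ 2 + F₁ * ddx
    x * (1 - x) * (dΦ₁ - 2 * L * Φ₁ + (L * L - dL) * F₀) -
      dx ^ 2 * (x * (1 - x) * F₂ + (1 - (1 / 3 + 2 / 3 + 1) * x) * F₁ - 1 / 3 * (2 / 3) * F₀) = 0 := by
  intro F₁ F₂ dP dQ dx L dL ddx Φ₁ dΦ₁
  simp only [F₁, F₂, dP, dQ, dx, L, dL, ddx, Φ₁, dΦ₁]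
  ring

/-- `V := (Φ₁ − LΦ)/y = (Φ/y)'`. [folklore] -/
def VR (u : ℝ) : ℝ := (PhiR₁ u - LR u * PhiR u) / yR u

/-- `y > 0` for `u > √3/6`. [folklore] -/
theorem yR_pos {u : ℝ} (hu : Real.sqrt 3 / 6 < u) : 0 < yR u := Real.sqrt_pos.mpr (pR_pos hu)

/-- `(Φ/y)' = V`. [folklore] -/
theorem hasDerivAt_PhiR_div_yR {u : ℝ} (hu : Real.sqrt 3 / 6 < u) :
    HasDerivAt (fun s => PhiR s / yR s) (VR u) u := by
  have hu0 : 0 < u := lt_trans (by positivity) hu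
  have hy := (yR_pos hu).ne'
  have h := (hasDerivAt_PhiR hu0).div (hasDerivAt_yR hu) hy
  refine h.congr_deriv ?_
  rw [VR]
  field_simp

/-- **`V' = 0` on `(√3/6, ∞)`.** [folklore] -/
theorem hasDerivAt_VR {u : ℝ} (hu : Real.sqrt 3 / 6 < u) : HasDerivAt VR 0 u := by
  have hu0 : 0 < u := lt_trans (by positivity) hu
  have hΦ := hasDerivAt_PhiR hu0
  have hΦ₁ := hasDerivAt_PhiR₁ hu0
  have hL := hasDerivAt_LR hu0
  have hY := hasDerivAt_yR hu
  have hYne : yR u ≠ 0 := (yR_pos hu).ne'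
  have h := (hΦ₁.sub (hL.mul hΦ)).div hY hYne
  refine (h.congr_of_eventuallyEq (Eventually.of_forall fun s => rfl)).congr_deriv ?_
  have hode := ordinaryHypergeometric_ode (a := (1 / 3 : ℝ)) (b := 2 / 3) (c := 1) one_pos (abs_xR_lt_one hu0)
  obtain ⟨hx0, hx1⟩ := xR_mem_Ioo hu0
  have hxx : xR u * (1 - xR u) ≠ 0 := mul_ne_zero hx0.ne' (sub_ne_zero.mpr hx1.ne.symm)
  have key := cubic_key_identity (pR u) (qR u) (xR u) π (ordinaryHypergeometric (1 / 3 : ℝ) (2 / 3) 1 (xR u))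
    (ordinaryHypergeometric (1 / 3 + 1 : ℝ) (2 / 3 + 1) (1 + 1) (xR u))
    (ordinaryHypergeometric (1 / 3 + 1 + 1 : ℝ) (2 / 3 + 1 + 1) (1 + 1 + 1) (xR u))
  simp only [PhiR, PhiR₁, LR, Pi.sub_apply, Pi.mul_apply] at hode key ⊢
  -- the bracket `Φ₁' − 2LΦ₁ + (L² − L')Φ` vanishes
  have hSTAR : ((1 / 3 : ℝ) * (2 / 3) / 1 * ((1 / 3 + 1) * (2 / 3 + 1) / (1 + 1) *
          ordinaryHypergeometric (1 / 3 + 1 + 1 : ℝ) (2 / 3 + 1 + 1) (1 + 1 + 1) (xR u)) *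
          (-(2 * π) * pR u * xR u * (1 - xR u)) ^ 2 +
        (1 / 3 : ℝ) * (2 / 3) / 1 * ordinaryHypergeometric (1 / 3 + 1 : ℝ) (2 / 3 + 1) (1 + 1) (xR u) *
          (-(2 * π) * ((-(π / 6) * pR u * (qR u + pR u * (8 * xR u - 4))) * xR u * (1 - xR u) +
            pR u * ((-(2 * π) * pR u * xR u * (1 - xR u)) * (1 - xR u) +
              xR u * (-(-(2 * π) * pR u * xR u * (1 - xR u)))))))
      - 2 * (-(π / 12) * (qR u + pR u * (8 * xR u - 4))) *
        ((1 / 3 : ℝ) * (2 / 3) / 1 * ordinaryHypergeometric (1 / 3 + 1 : ℝ) (2 / 3 + 1) (1 + 1) (xR u) *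
          (-(2 * π) * pR u * xR u * (1 - xR u)))
      + ((-(π / 12) * (qR u + pR u * (8 * xR u - 4))) * (-(π / 12) * (qR u + pR u * (8 * xR u - 4))) -
          (-(π / 12) * (-(π / 12) * (qR u ^ 2 - 16 * pR u ^ 2) +
            (-(π / 6) * pR u * (qR u + pR u * (8 * xR u - 4)) * (8 * xR u - 4) +
              pR u * (8 * (-(2 * π) * pR u * xR u * (1 - xR u))))))) *
        ordinaryHypergeometric (1 / 3 : ℝ) (2 / 3) 1 (xR u) = 0 := by
    have h2 : xR u * (1 - xR u) * (((1 / 3 : ℝ) * (2 / 3) / 1 * ((1 / 3 + 1) * (2 / 3 + 1) / (1 + 1) *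
          ordinaryHypergeometric (1 / 3 + 1 + 1 : ℝ) (2 / 3 + 1 + 1) (1 + 1 + 1) (xR u)) *
          (-(2 * π) * pR u * xR u * (1 - xR u)) ^ 2 +
        (1 / 3 : ℝ) * (2 / 3) / 1 * ordinaryHypergeometric (1 / 3 + 1 : ℝ) (2 / 3 + 1) (1 + 1) (xR u) *
          (-(2 * π) * ((-(π / 6) * pR u * (qR u + pR u * (8 * xR u - 4))) * xR u * (1 - xR u) +
            pR u * ((-(2 * π) * pR u * xR u * (1 - xR u)) * (1 - xR u) +
              xR u * (-(-(2 * π) * pR u * xR u * (1 - xR u)))))))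
      - 2 * (-(π / 12) * (qR u + pR u * (8 * xR u - 4))) *
        ((1 / 3 : ℝ) * (2 / 3) / 1 * ordinaryHypergeometric (1 / 3 + 1 : ℝ) (2 / 3 + 1) (1 + 1) (xR u) *
          (-(2 * π) * pR u * xR u * (1 - xR u)))
      + ((-(π / 12) * (qR u + pR u * (8 * xR u - 4))) * (-(π / 12) * (qR u + pR u * (8 * xR u - 4))) -
          (-(π / 12) * (-(π / 12) * (qR u ^ 2 - 16 * pR u ^ 2) +
            (-(π / 6) * pR u * (qR u + pR u * (8 * xR u - 4)) * (8 * xR u - 4) +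
              pR u * (8 * (-(2 * π) * pR u * xR u * (1 - xR u))))))) *
        ordinaryHypergeometric (1 / 3 : ℝ) (2 / 3) 1 (xR u)) = 0 := by
      linear_combination key + (-(2 * π) * pR u * xR u * (1 - xR u)) ^ 2 * hode
    exact (mul_eq_zero.mp h2).resolve_left hxx
  rw [div_eq_zero_iff]
  left
  linear_combination yR u * hSTAR

/-- `Φ/y = α + βu` on `(√3/6, ∞)`. [folklore] -/
theorem exists_PhiR_div_yR_affine :
    ∃ α β : ℝ, ∀ u : ℝ, Real.sqrt 3 / 6 < u → PhiR u / yR u = α + β * u := by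
  set s : Set ℝ := Set.Ioi (Real.sqrt 3 / 6)
  obtain ⟨β, hβ⟩ := IsOpen.exists_is_const_of_deriv_eq_zero (f := VR) isOpen_Ioi
    (convex_Ioi (Real.sqrt 3 / 6)).isPreconnected
    (fun u hu => (hasDerivAt_VR hu).differentiableAt.differentiableWithinAt)
    (fun u hu => (hasDerivAt_VR hu).deriv)
  have hd : ∀ u : ℝ, Real.sqrt 3 / 6 < u → HasDerivAt (fun v => PhiR v / yR v - β * v) 0 u := by
    intro u hu
    have h1 := (hasDerivAt_PhiR_div_yR hu).fun_sub ((hasDerivAt_id u).const_mul β)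
    refine (h1.congr_of_eventuallyEq (Eventually.of_forall fun v => by simp)).congr_deriv ?_
    rw [hβ u hu]; simp
  obtain ⟨α, hα⟩ := IsOpen.exists_is_const_of_deriv_eq_zero (f := fun v => PhiR v / yR v - β * v)
    isOpen_Ioi (convex_Ioi (Real.sqrt 3 / 6)).isPreconnected
    (fun u hu => (hd u hu).differentiableAt.differentiableWithinAt)
    (fun u hu => (hd u hu).deriv)
  refine ⟨α, β, fun u hu => ?_⟩
  have h2 : PhiR u / yR u - β * u = α := hα u hu
  linarith

/-! ### Limits at `∞` -/

/-- `axisPt → i∞` as `u → ∞`. [folklore] -/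
theorem tendsto_axisPt_atTop : Tendsto axisPt atTop atImInfty := by
  rw [atImInfty, tendsto_comap_iff]
  refine tendsto_atTop_atTop.mpr fun b => ⟨max b 1, fun u hu => ?_⟩
  have hu0 : 0 < u := lt_of_lt_of_le one_pos ((le_max_right _ _).trans hu)
  rw [Function.comp_apply, im_axisPt hu0]
  exact (le_max_left _ _).trans hu

/-- `pR → 1`. [folklore] -/
theorem tendsto_pR_atTop : Tendsto pR atTop (𝓝 1) := by
  have h3 : Tendsto (fun s : ℝ => e₂ (3 * s)) atTop (𝓝 1) :=
    tendsto_e₂_atTop.comp (tendsto_id.const_mul_atTop (by norm_num : (0:ℝ) < 3))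
  have h := ((h3.const_mul 3).sub tendsto_e₂_atTop).div_const 2
  rw [show ((3 : ℝ) * 1 - 1) / 2 = 1 by norm_num] at h
  exact h.congr fun s => rfl

/-- `x → 0` (`t → ∞` since `q t → 1`, `q → 0`). [folklore] -/
theorem tendsto_xR_atTop : Tendsto xR atTop (𝓝 0) := by
  -- `x = 27 q/(q t + 27 q)` along the axis
  have hq0 : Tendsto (fun u : ℝ => qq (axisPt u)) atTop (𝓝 0) :=
    (tendsto_nhdsWithin_iff.mp tendsto_qq).1.comp tendsto_axisPt_atTop
  have hqt : Tendsto (fun u : ℝ => qq (axisPt u) * tThree (axisPt u)) atTop (𝓝 1) :=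
    tendsto_qq_mul_tThree.comp tendsto_axisPt_atTop
  have h := (hq0.const_mul 27).div (hqt.add (hq0.const_mul 27)) (by norm_num)
  rw [mul_zero, zero_div] at h
  have h' : Tendsto (fun u : ℝ => ((xR u : ℝ) : ℂ)) atTop (𝓝 0) := by
    refine h.congr' ?_
    filter_upwards [eventually_gt_atTop 0] with u hu
    have hqne := qq_ne_zero (axisPt u)
    simp only [Pi.div_apply]
    rw [xR, (tThree_axisPt_eq hu).1]
    have ht := (tThree_axisPt_eq hu).2
    have hne : ((tR u : ℂ) + 27) ≠ 0 := by
      intro h0; have := congrArg Complex.re h0; simp at this; linarith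
    push_cast
    field_simp
  have := (Complex.continuous_re.tendsto 0).comp h'
  refine (this.congr fun u => ?_).trans (by simp)
  simp

/-- `Φ → 1`. [folklore] -/
theorem tendsto_PhiR_atTop : Tendsto PhiR atTop (𝓝 1) := by
  have hc : ContinuousAt (fun x : ℝ => ordinaryHypergeometric (1 / 3 : ℝ) (2 / 3) 1 x) 0 :=
    (continuousOn_ordinaryHypergeometric (1 / 3 : ℝ) (2 / 3) 1).continuousAt (Metric.ball_mem_nhds (0 : ℝ) one_pos)
  have h0 : ordinaryHypergeometric (1 / 3 : ℝ) (2 / 3) 1 (0 : ℝ) = 1 := ordinaryHypergeometric_zero _ _ _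
  have h := hc.tendsto.comp tendsto_xR_atTop
  rw [h0] at h
  exact h

/-- `y → 1`. [folklore] -/
theorem tendsto_yR_atTop : Tendsto yR atTop (𝓝 1) := by
  have h := (Real.continuous_sqrt.tendsto 1).comp tendsto_pR_atTop
  rw [Real.sqrt_one] at h
  exact h

/-- **`Φ = y` on `(√3/6, ∞)`**, i.e. **`𝓟(iu) = ₂F₁(⅓,⅔;1;x₃(u))²`** (Ramanujan's cubic signature identity
`a(q)² = (3E₂(3τ) − E₂(τ))/2`, `a = ₂F₁(⅓,⅔;1;c³/a³)`, on the imaginary axis). [cite: Zhou2015, eq. (P_nu_sqr_E2_diff)] -/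
theorem pR_eq_hypergeometric_sq {u : ℝ} (hu : Real.sqrt 3 / 6 < u) :
    pR u = ordinaryHypergeometric (1 / 3 : ℝ) (2 / 3) 1 (xR u) ^ 2 := by
  obtain ⟨α, β, hαβ⟩ := exists_PhiR_div_yR_affine
  have hlim : Tendsto (fun s => PhiR s / yR s) atTop (𝓝 1) := by
    have := tendsto_PhiR_atTop.div tendsto_yR_atTop one_ne_zero
    rwa [div_one] at this
  have hlim' : Tendsto (fun s => α + β * s) atTop (𝓝 1) :=
    hlim.congr' (by filter_upwards [eventually_gt_atTop (Real.sqrt 3 / 6)] with s hs using hαβ s hs)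
  have hβ : β = 0 := by
    by_contra hβ
    rcases lt_or_gt_of_ne hβ with hneg | hpos
    · have : Tendsto (fun s => α + β * s) atTop atBot :=
        tendsto_atBot_add_const_left _ α (tendsto_id.const_mul_atTop_of_neg hneg)
      exact not_tendsto_nhds_of_tendsto_atBot this 1 hlim'
    · have : Tendsto (fun s => α + β * s) atTop atTop :=
        tendsto_atTop_add_const_left _ α (tendsto_id.const_mul_atTop hpos)
      exact not_tendsto_nhds_of_tendsto_atTop this 1 hlim'
  have hα : α = 1 := by
    rw [hβ] at hlim'
    simp only [zero_mul, add_zero] at hlim'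
    exact tendsto_nhds_unique tendsto_const_nhds hlim'
  have h := hαβ u hu
  rw [hα, hβ, zero_mul, add_zero, div_eq_one_iff_eq (yR_pos hu).ne'] at h
  -- `Φ = y = √pR`
  have hp := pR_pos hu
  rw [PhiR, yR] at h
  rw [h, Real.sq_sqrt hp.le]

/-! ## 5. The substitution `ξ = 1 − 2x₃ = (t − 27)/(t + 27)` -/

/-- `ξ(u) := 1 − 2x₃(u)`. [folklore] -/
def xiR (u : ℝ) : ℝ := 1 - 2 * xR u

/-- **`𝓟(iu) = P_{−1/3}(ξ(u))²`** for `u > √3/6`. [cite: Zhou2015, eq. (P_nu_sqr_E2_diff)] -/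
theorem pR_eq_legendreP_sq {u : ℝ} (hu : Real.sqrt 3 / 6 < u) : pR u = legendreP (-1 / 3) (xiR u) ^ 2 := by
  rw [pR_eq_hypergeometric_sq hu, legendreP, xiR]
  congr 2 <;> norm_num

/-- **`ξ' = 4π𝓟x(1−x) > 0`.** [folklore] -/
theorem hasDerivAt_xiR {u : ℝ} (hu : 0 < u) : HasDerivAt xiR (4 * π * pR u * xR u * (1 - xR u)) u := by
  have h := ((hasDerivAt_xR hu).const_mul 2).const_sub 1
  refine (h.congr_of_eventuallyEq (Eventually.of_forall fun v => rfl)).congr_deriv ?_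
  ring

/-- `ξ' > 0` on `u > √3/6`. [folklore] -/
theorem deriv_xiR_pos {u : ℝ} (hu : Real.sqrt 3 / 6 < u) : 0 < 4 * π * pR u * xR u * (1 - xR u) := by
  have hu0 : 0 < u := lt_trans (by positivity) hu
  obtain ⟨hx0, hx1⟩ := xR_mem_Ioo hu0
  have hp := pR_pos hu
  have : 0 < 1 - xR u := by linarith
  positivity

/-- **The integrand in the new variable**: `f₃(iu) = (108π)⁻¹ · P_{−1/3}(ξ(u))² · ξ'(u)` for `u > √3/6`
(`Δ₃/𝓟 = 𝓟²x(1−x)/27` by `𝓟³t = Δ₃(t+27)²`). [folklore] -/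
theorem fThreeR_eq {u : ℝ} (hu : Real.sqrt 3 / 6 < u) :
    dR u / pR u = (108 * π)⁻¹ * (|4 * π * pR u * xR u * (1 - xR u)| * legendreP (-1 / 3) (xiR u) ^ 2) := by
  have hu0 : 0 < u := lt_trans (by positivity) hu
  rw [abs_of_pos (deriv_xiR_pos hu), ← pR_eq_legendreP_sq hu]
  have hp := (pR_pos hu).ne'
  have ht := (tThree_axisPt_eq hu0).2
  have hα := pR_cube_mul_tR hu0
  have hx := xR_mul_one_sub hu0
  have hπ : (π : ℝ) ≠ 0 := Real.pi_ne_zero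
  have hne : tR u + 27 ≠ 0 := by linarith
  -- `dR = pR³ t/(t+27)² = pR³ x(1−x)/27`
  have hd : dR u = pR u ^ 3 * (xR u * (1 - xR u)) / 27 := by
    rw [hx]; field_simp; linear_combination -hα
  rw [hd]
  field_simp
  ring

/-- `ξ(1/√3) = 0` (`t(i/√3) = 27`). [folklore] -/
theorem xiR_inv_sqrt_three : xiR (1 / Real.sqrt 3) = 0 := by
  have h0 : (0 : ℝ) < 1 / Real.sqrt 3 := by positivity
  have ht : tR (1 / Real.sqrt 3) = 27 := by
    have := (tThree_axisPt_eq h0).1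
    rw [tThree_axisPt_inv_sqrt_three] at this
    exact_mod_cast this.symm
  rw [xiR, xR, ht]; norm_num

/-- `ξ < 1`. [folklore] -/
theorem xiR_lt_one {u : ℝ} (hu : 0 < u) : xiR u < 1 := by
  rw [xiR]; linarith [(xR_mem_Ioo hu).1]

/-- `ξ` is continuous on `u > 0`. [folklore] -/
theorem continuousAt_xiR {u : ℝ} (hu : 0 < u) : ContinuousAt xiR u := (hasDerivAt_xiR hu).continuousAt

/-- `√3/6 < 1/√3`. [folklore] -/
theorem sqrt_three_div_six_lt : Real.sqrt 3 / 6 < 1 / Real.sqrt 3 := by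
  have hs : 0 < Real.sqrt 3 := Real.sqrt_pos.mpr (by norm_num)
  have hss : Real.sqrt 3 * Real.sqrt 3 = 3 := Real.mul_self_sqrt (by norm_num)
  rw [div_lt_div_iff₀ (by norm_num) hs]; nlinarith

/-- `ξ` is strictly increasing on `(√3/6, ∞)`. [folklore] -/
theorem strictMonoOn_xiR : StrictMonoOn xiR (Set.Ioi (Real.sqrt 3 / 6)) := by
  have hs : 0 < Real.sqrt 3 / 6 := by positivity
  refine strictMonoOn_of_deriv_pos (convex_Ioi _) (fun u hu => (continuousAt_xiR (hs.trans hu)).continuousWithinAt)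
    fun u hu => ?_
  rw [interior_Ioi] at hu
  rw [(hasDerivAt_xiR (hs.trans hu)).deriv]
  exact deriv_xiR_pos hu

/-- `ξ → 1` as `u → ∞`. [folklore] -/
theorem tendsto_xiR_atTop : Tendsto xiR atTop (𝓝 1) := by
  have := (tendsto_xR_atTop.const_mul 2).const_sub 1
  show Tendsto (fun u => 1 - 2 * xR u) atTop (𝓝 1)
  simpa using this

/-- `ξ` maps `(1/√3, ∞)` onto `(0, 1)`. [folklore] -/
theorem image_xiR_Ioi : xiR '' Set.Ioi (1 / Real.sqrt 3) = Set.Ioo 0 1 := by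
  have ha : 0 < 1 / Real.sqrt 3 := by positivity
  have hb := sqrt_three_div_six_lt
  apply Set.Subset.antisymm
  · rintro y ⟨t, ht, rfl⟩
    have ht0 : 0 < t := ha.trans ht
    refine ⟨?_, xiR_lt_one ht0⟩
    rw [← xiR_inv_sqrt_three]
    exact strictMonoOn_xiR hb (hb.trans ht) ht
  · intro y hy
    obtain ⟨T₀, hT₀⟩ := (Filter.eventually_atTop.mp
      ((tendsto_xiR_atTop.eventually (lt_mem_nhds hy.2)).and (eventually_gt_atTop (1 / Real.sqrt 3))))
    have hT₀' := hT₀ T₀ le_rfl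
    have hcont : ContinuousOn xiR (Set.Icc (1 / Real.sqrt 3) T₀) := fun t ht =>
      (continuousAt_xiR (ha.trans_le ht.1)).continuousWithinAt
    have hmem : y ∈ Set.Icc (xiR (1 / Real.sqrt 3)) (xiR T₀) := by
      rw [xiR_inv_sqrt_three]; exact ⟨hy.1.le, hT₀'.1.le⟩
    obtain ⟨t, ht, hty⟩ := intermediate_value_Icc hT₀'.2.le hcont hmem
    have ht1 : t ≠ 1 / Real.sqrt 3 := by
      rintro rfl
      rw [xiR_inv_sqrt_three] at hty
      exact absurd hty hy.1.ne
    exact ⟨t, lt_of_le_of_ne ht.1 (Ne.symm ht1), hty⟩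

/-- **`∫_{1/√3}^∞ Δ₃(iu)/𝓟(iu) du = (108π)⁻¹ ∫₀¹ P_{−1/3}(ξ)² dξ`** (real form). [cite: Zhou2015, Remark 9] -/
theorem integral_fThreeR_axis :
    ∫ u in Set.Ioi (1 / Real.sqrt 3), dR u / pR u = (108 * π)⁻¹ * ∫ ξ in (0 : ℝ)..1, legendreP (-1 / 3) ξ ^ 2 := by
  have ha : 0 < 1 / Real.sqrt 3 := by positivity
  have hb := sqrt_three_div_six_lt
  have himage := integral_image_eq_integral_abs_deriv_smul (f := xiR)
    (f' := fun u => 4 * π * pR u * xR u * (1 - xR u)) measurableSet_Ioi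
    (fun t ht => (hasDerivAt_xiR (ha.trans ht)).hasDerivWithinAt)
    (strictMonoOn_xiR.injOn.mono (Set.Ioi_subset_Ioi hb.le))
    (fun ξ => legendreP (-1 / 3) ξ ^ 2)
  rw [image_xiR_Ioi] at himage
  rw [intervalIntegral.integral_of_le zero_le_one, integral_Ioc_eq_integral_Ioo, himage,
    ← integral_const_mul]
  refine setIntegral_congr_fun measurableSet_Ioi fun u hu => ?_
  rw [fThreeR_eq (hb.trans hu), smul_eq_mul]

/-- **The level-three axis integral, complex form** (the hypothesis `hL` of
`GreenLevelThreeEichlerIntegral.higherGreen_cmLevelThree_of_axis`):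
`∫_{u>1/√3} f₃(iu) du = (108π)⁻¹ ∫₀¹ P_{−1/3}(ξ)² dξ`. [cite: Zhou2015, Remark 9] -/
theorem integral_fThree_axis :
    ∫ u in Set.Ioi (1 / Real.sqrt 3), fThree (axisPt u) =
      ((((108 * π)⁻¹ * ∫ ξ in (0 : ℝ)..1, legendreP (-1 / 3) ξ ^ 2 : ℝ)) : ℂ) := by
  have ha : 0 < 1 / Real.sqrt 3 := by positivity
  rw [← integral_fThreeR_axis, ← integral_complex_ofReal]
  exact setIntegral_congr_fun measurableSet_Ioi fun u hu => fThree_axisPt_real u (ha.trans hu)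

end Literature.NumberTheory.ModularForms

end
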